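import Literature.MathematicalPhysics.QuantumManyBody.TorusBoseFockLayer
import Literature.MathematicalPhysics.QuantumManyBody.PeriodicCondensateCoherence
import HarnessLib

/-!
# Route `BECInfDivCoherence`, support item `GridAverageCondensate` (stmt-AtomisticToContinuum-9116) —
# helper: aliasing of the coarse grid in momentum space (one-body Fourier bookkeeping)

One-body toolkit for the proof of `GridAverageCondensate` (file
`BECInfDivCoherenceGridAverageCondensate.lean`), on the periodic cell `[0,L)³` with the Fourier
machinery of `PeriodicBoseGasFourier.lean` (`cellWave`, `cellFourierCoeff`):

* `hasSum_conj_cellFourierCoeff_mul'` — polarised Parseval `Σₙ conj ĉₙ(φ) ĉₙ(ψ) = L⁻³∫ conj φ ψ`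
  (Mathlib's `UnitAddTorus.hasSum_prod_mFourierCoeff`, transported);
* `conj_cellFourierCoeff_translate_mul` — the translate rule `ĉ_k(φ(· + t)) = e_k(t) ĉ_k(φ)` in
  autocorrelation form `conj ĉ_k(φ(· + t)) ĉ_k(φ) = conj e_k(t) |ĉ_k(φ)|²`;
* `sum_exp_two_pi_div`, `sum_cellWave_grid` — roots of unity: the character sum over the `m³` grid
  nodes `(L/m)j` is `Σⱼ e_k((L/m)j) = m³ · [k ∈ mℤ³]`;
* `hasSum_grid`, `sum_integral_translate_eq` — **aliasing identity**
  `Σⱼ ∫_cell conj φ(x + (L/m)j) φ(x) dx = L³ m³ Σ_{k ∈ mℤ³} |ĉ_k(φ)|²` for continuous periodic `φ`;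
* `tsum_coarse_le` — **aliasing bound** `Σ_{k ∈ mℤ³} |ĉ_k|² ≤ |ĉ_0|² + (L²/(4π²m²)) Σ_k |2πk/L|²|ĉ_k|²`
  (`|k| ≥ m` on `mℤ³ ∖ {0}`), in `ℝ≥0∞`;
* `setIntegral_cellN_comp_perm` — relabelling invariance of the Bochner integral `∫_{cell^N}`
  (companion of `lintegral_cellN_comp_perm`).

All folklore (finite Fourier analysis on the torus; cf. [LSSY2005, App. A (A.3)–(A.6)] for the
plane-wave conventions `k = 2πn/L`).
-/

noncomputable section

open MeasureTheory Filter Complex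
open scoped ENNReal NNReal ComplexConjugate

namespace Summit.AtomisticToContinuum.BoseEinsteinCondensation.Theorems.BECInfDivCoherenceGridAverage

open Literature.MathematicalPhysics.QuantumManyBody.BoseGas

variable {L : ℝ}

/-! ### A generic measure-theoretic helper -/

/-- **Relabelling particles preserves Bochner integrals over `cell^N`**: `∫_{cell^N} F(X ∘ σ) dX =
∫_{cell^N} F(X) dX` (the Bochner companion of `lintegral_cellN_comp_perm`). [folklore] -/
theorem setIntegral_cellN_comp_perm {N : ℕ} (L : ℝ) (σ : Equiv.Perm (Fin N)) (F : Config N → ℂ) :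
    ∫ X in cellN N L, F (X ∘ σ) = ∫ X in cellN N L, F X := by
  set e := (MeasurableEquiv.piCongrLeft (fun _ : Fin N => Space) σ).symm with he
  have hmp : MeasurePreserving e volume volume :=
    (volume_measurePreserving_piCongrLeft (fun _ : Fin N => Space) σ).symm
  have heX : ∀ (X : Config N) (j : Fin N), e X j = X (σ j) := fun X j => rfl
  have hpre : e ⁻¹' cellN N L = cellN N L := by
    ext X
    simp only [Set.mem_preimage, cellN, Set.mem_setOf_eq, heX]
    exact ⟨fun h i => by simpa using h (σ.symm i), fun h i => h _⟩
  have key := hmp.setIntegral_preimage_emb e.measurableEmbedding F (cellN N L)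
  rw [hpre] at key
  exact key

/-! ### Fourier bookkeeping on the cell -/

/-- **Parseval on the cell, inner-product form**: for continuous `φ, ψ : ℝ³ → ℂ`,
`∑ₙ conj(ĉₙ(φ)) ĉₙ(ψ) = L⁻³ ∫_{[0,L)³} conj(φ) ψ` (Mathlib's `UnitAddTorus.hasSum_prod_mFourierCoeff`
transported like `hasSum_sq_cellFourierCoeff`; same statement as
`IMUChainGlue.hasSum_conj_cellFourierCoeff_mul`, re-proved here to keep the import cone small). [folklore] -/
theorem hasSum_conj_cellFourierCoeff_mul' (hL : 0 < L) {φ ψ : Space → ℂ}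
    (hφ : Continuous φ) (hψ : Continuous ψ) :
    HasSum (fun n => conj (cellFourierCoeff L φ n) * cellFourierCoeff L ψ n)
      (((L ^ 3)⁻¹ : ℝ) • ∫ x in cell L, conj (φ x) * ψ x) := by
  have hf := memLp_torusFun hL hφ
  have hg := memLp_torusFun hL hψ
  have hP := UnitAddTorus.hasSum_prod_mFourierCoeff (hf.toLp _) (hg.toLp _)
  have hcf : ∀ n, UnitAddTorus.mFourierCoeff (hf.toLp _ : UnitAddTorus (Fin 3) → ℂ) n =
      cellFourierCoeff L φ n := fun n =>
    integral_congr_ae (hf.coeFn_toLp.mono fun t ht => by simp only [ht])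
  have hcg : ∀ n, UnitAddTorus.mFourierCoeff (hg.toLp _ : UnitAddTorus (Fin 3) → ℂ) n =
      cellFourierCoeff L ψ n := fun n =>
    integral_congr_ae (hg.coeFn_toLp.mono fun t ht => by simp only [ht])
  rw [← integral_fromUnitTorus hL (fun x : Space => conj (φ x) * ψ x)]
  convert hP using 1
  · funext n
    rw [hcf, hcg]
  · exact integral_congr_ae ((hf.coeFn_toLp.and hg.coeFn_toLp).mono fun t ht => by
      simp only [ht.1, ht.2, torusFun])

/-- **Fourier coefficients of the autocorrelation pair**: for an `Lℤ³`-periodic `φ`,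
`conj ĉ_q(φ(· + t)) · ĉ_q(φ) = conj e_q(t) · |ĉ_q(φ)|²` — the translate rule
`ĉ_q(φ(· + t)) = e_q(t) ĉ_q(φ)` (shift invariance of the cell integral of the periodic `e_{-q} φ`,
as in `Cruxes.PeriodicIRBound.LinearPhFloorWagner.WF.cellFourierCoeff_comp_add`, re-derived inline to
keep the import cone inside `Literature`) paired with `conj z · z = |z|²`. [folklore] -/
theorem conj_cellFourierCoeff_translate_mul (hL : 0 < L) {φ : Space → ℂ}
    (hφ : ∀ (x : Space) (k : Fin 3), φ (x + EuclideanSpace.single k L) = φ x) (t : Space)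
    (q : Fin 3 → ℤ) :
    conj (cellFourierCoeff L (fun s => φ (s + t)) q) * cellFourierCoeff L φ q =
      conj (cellWave L q t) * (((‖cellFourierCoeff L φ q‖ ^ 2 : ℝ)) : ℂ) := by
  -- the translate rule `ĉ_q(φ(· + t)) = e_q(t) ĉ_q(φ)`
  have htrans : cellFourierCoeff L (fun s => φ (s + t)) q = cellWave L q t * cellFourierCoeff L φ q := by
    rw [cellFourierCoeff_eq_integral hL, cellFourierCoeff_eq_integral hL, Complex.real_smul,
      Complex.real_smul]
    simp only [conj_cellWave]
    have hH : ∀ (x : Space) (k : Fin 3),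
        (fun y => cellWave L (-q) y * φ y) (x + EuclideanSpace.single k L) =
          (fun y => cellWave L (-q) y * φ y) x := fun x k => by
      simp only [cellWave_periodic hL.ne', hφ]
    have hshift :=
      setIntegral_cell_comp_add_of_periodic hL (H := fun y => cellWave L (-q) y * φ y) hH t
    have h1 : cellWave L q t * cellWave L (-q) t = 1 := by
      rw [← cellWave_add_index, add_neg_cancel, cellWave_zero]
    have hpt : ∀ x : Space, cellWave L (-q) x * φ (x + t) =
        cellWave L q t * (cellWave L (-q) (x + t) * φ (x + t)) := by
      intro x
      rw [cellWave_add L (-q) x t]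
      calc cellWave L (-q) x * φ (x + t)
          = (cellWave L q t * cellWave L (-q) t) * (cellWave L (-q) x * φ (x + t)) := by
            rw [h1, one_mul]
        _ = cellWave L q t * (cellWave L (-q) x * cellWave L (-q) t * φ (x + t)) := by ring
    rw [setIntegral_congr_fun (measurableSet_cell L) (fun x _ => hpt x), integral_const_mul, hshift]
    ring
  rw [htrans, map_mul, mul_assoc, conj_mul']
  push_cast
  ring

/-- **Roots of unity**: `Σ_{t < m} e^{2πi k t/m} = m` if `m ∣ k` and `0` otherwise. [folklore] -/
theorem sum_exp_two_pi_div (m : ℕ) (hm : 0 < m) (k : ℤ) :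
    ∑ t : Fin m, Complex.exp (2 * Real.pi * Complex.I * k * ((t : ℕ) : ℂ) / m) =
      if (m : ℤ) ∣ k then (m : ℂ) else 0 := by
  set ζ : ℂ := Complex.exp (2 * Real.pi * Complex.I * k / m) with hζ
  have hm0 : (m : ℂ) ≠ 0 := by exact_mod_cast hm.ne'
  have hI : (2 * Real.pi * Complex.I : ℂ) ≠ 0 :=
    mul_ne_zero (mul_ne_zero two_ne_zero (by exact_mod_cast Real.pi_ne_zero)) Complex.I_ne_zero
  have hterm : ∀ t : ℕ, Complex.exp (2 * Real.pi * Complex.I * k * ((t : ℕ) : ℂ) / m) = ζ ^ t := by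
    intro t
    rw [hζ, ← Complex.exp_nat_mul]
    congr 1
    ring
  simp only [hterm]
  rw [Fin.sum_univ_eq_sum_range (fun t => ζ ^ t) m]
  have hζm : ζ ^ m = 1 := by
    rw [hζ, ← Complex.exp_nat_mul]
    have : (m : ℂ) * (2 * Real.pi * Complex.I * k / m) = k * (2 * Real.pi * Complex.I) := by
      field_simp
    rw [this, Complex.exp_int_mul_two_pi_mul_I]
  by_cases hdvd : (m : ℤ) ∣ k
  · obtain ⟨c, hc⟩ := hdvd
    have hζ1 : ζ = 1 := by
      rw [hζ, hc]
      have : (2 * Real.pi * Complex.I * (((m : ℤ) * c : ℤ) : ℂ) / m : ℂ) =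
          c * (2 * Real.pi * Complex.I) := by
        push_cast
        field_simp
      rw [this, Complex.exp_int_mul_two_pi_mul_I]
    rw [if_pos ⟨c, hc⟩, hζ1]
    simp
  · rw [if_neg hdvd]
    have hζ1 : ζ ≠ 1 := by
      intro h1
      rw [hζ, Complex.exp_eq_one_iff] at h1
      obtain ⟨c, hc⟩ := h1
      apply hdvd
      have h3 : (k : ℂ) = c * m := by
        calc (k : ℂ) = (2 * Real.pi * Complex.I * k / m) * m / (2 * Real.pi * Complex.I) := by
              field_simp
          _ = c * (2 * Real.pi * Complex.I) * m / (2 * Real.pi * Complex.I) := by rw [hc]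
          _ = c * m := by field_simp
      have h4 : k = c * m := by exact_mod_cast h3
      exact ⟨c, by rw [h4, mul_comm]⟩
    rw [geom_sum_eq hζ1, hζm, sub_self, zero_div]

/-- **Character sum over the grid**: for `k ∈ ℤ³` and the `m³` nodes `(L/m) j`, `j ∈ {0,…,m-1}³`,
`Σⱼ e_k((L/m) j) = m³` if `k ∈ mℤ³` and `0` otherwise. [folklore] -/
theorem sum_cellWave_grid (hL : L ≠ 0) {m : ℕ} (hm : 0 < m) (k : Fin 3 → ℤ) :
    ∑ j : Fin 3 → Fin m, cellWave L k (latticeVec (L / m) (fun a => ((j a : ℕ) : ℤ))) =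
      if (∀ a, (m : ℤ) ∣ k a) then (m : ℂ) ^ 3 else 0 := by
  have hm0 : (m : ℂ) ≠ 0 := by exact_mod_cast hm.ne'
  have hL' : (L : ℂ) ≠ 0 := by exact_mod_cast hL
  have hpt : ∀ j : Fin 3 → Fin m, cellWave L k (latticeVec (L / m) (fun a => ((j a : ℕ) : ℤ))) =
      ∏ a : Fin 3, Complex.exp (2 * Real.pi * Complex.I * (k a) * (((j a : ℕ) : ℕ) : ℂ) / m) := by
    intro j
    rw [cellWave_apply, ← Complex.exp_sum]
    congr 1
    simp only [latticeVec, PiLp.toLp_apply, Int.cast_natCast]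
    push_cast
    rw [Finset.mul_sum, Finset.sum_div]
    refine Finset.sum_congr rfl fun a _ => ?_
    field_simp
  simp only [hpt]
  rw [← Fintype.prod_sum (fun a (t : Fin m) =>
    Complex.exp (2 * Real.pi * Complex.I * (k a) * ((t : ℕ) : ℂ) / m))]
  simp only [sum_exp_two_pi_div m hm]
  by_cases hD : ∀ a, (m : ℤ) ∣ k a
  · rw [if_pos hD]
    rw [Finset.prod_congr rfl (fun a _ => if_pos (hD a))]
    simp
  · rw [if_neg hD]
    obtain ⟨a, ha⟩ := not_forall.mp hD
    exact Finset.prod_eq_zero (Finset.mem_univ a) (if_neg ha)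

/-- **Grid sum of autocorrelations of a periodic function, momentum form.** For continuous
`Lℤ³`-periodic `φ` and `m ≥ 1`,
`L⁻³ Σⱼ ∫_cell conj φ(x + (L/m)j) φ(x) dx = Σ_{k ∈ mℤ³} m³ |ĉ_k(φ)|²` as a complex `HasSum`
(polarised Parseval + translate rule + character sum). [folklore] -/
theorem hasSum_grid (hL : 0 < L) {m : ℕ} (hm : 0 < m) {φ : Space → ℂ} (hφ : Continuous φ)
    (hper : ∀ (x : Space) (k : Fin 3), φ (x + EuclideanSpace.single k L) = φ x) :
    HasSum (fun k : Fin 3 → ℤ =>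
        (((if (∀ a, (m : ℤ) ∣ k a) then (m : ℝ) ^ 3 * ‖cellFourierCoeff L φ k‖ ^ 2 else 0 : ℝ)) : ℂ))
      (((L ^ 3)⁻¹ : ℝ) • ∑ j : Fin 3 → Fin m,
        ∫ x in cell L, conj (φ (x + latticeVec (L / m) (fun a => ((j a : ℕ) : ℤ)))) * φ x) := by
  have hj : ∀ j : Fin 3 → Fin m, HasSum (fun k : Fin 3 → ℤ =>
      conj (cellWave L k (latticeVec (L / m) (fun a => ((j a : ℕ) : ℤ)))) *
        (((‖cellFourierCoeff L φ k‖ ^ 2 : ℝ)) : ℂ))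
      (((L ^ 3)⁻¹ : ℝ) • ∫ x in cell L,
        conj (φ (x + latticeVec (L / m) (fun a => ((j a : ℕ) : ℤ)))) * φ x) := by
    intro j
    have h := hasSum_conj_cellFourierCoeff_mul' hL
      (φ := fun x => φ (x + latticeVec (L / m) (fun a => ((j a : ℕ) : ℤ))))
      (hφ.comp (continuous_id.add continuous_const)) hφ
    convert h using 1
    funext k
    exact (conj_cellFourierCoeff_translate_mul hL hper _ k).symm
  have hsum := hasSum_sum (s := (Finset.univ : Finset (Fin 3 → Fin m))) fun j _ => hj j
  rw [← Finset.smul_sum] at hsum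
  convert hsum using 1
  funext k
  rw [← Finset.sum_mul, ← map_sum, sum_cellWave_grid hL.ne' hm k]
  split_ifs with hD
  · rw [map_pow, Complex.conj_natCast]
    push_cast
    ring
  · simp

/-- **Real form of `hasSum_grid`**: the coarse-lattice Parseval sum is summable, and
`Σⱼ ∫_cell conj φ(x + (L/m)j) φ(x) dx = L³ Σ_{k ∈ mℤ³} m³ |ĉ_k(φ)|²` (a real number). [folklore] -/
theorem sum_integral_translate_eq (hL : 0 < L) {m : ℕ} (hm : 0 < m) {φ : Space → ℂ}
    (hφ : Continuous φ)
    (hper : ∀ (x : Space) (k : Fin 3), φ (x + EuclideanSpace.single k L) = φ x) :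
    Summable (fun k : Fin 3 → ℤ =>
        (if (∀ a, (m : ℤ) ∣ k a) then (m : ℝ) ^ 3 * ‖cellFourierCoeff L φ k‖ ^ 2 else 0 : ℝ)) ∧
    (∑ j : Fin 3 → Fin m,
        ∫ x in cell L, conj (φ (x + latticeVec (L / m) (fun a => ((j a : ℕ) : ℤ)))) * φ x) =
      (((L ^ 3 * ∑' k : Fin 3 → ℤ,
        (if (∀ a, (m : ℤ) ∣ k a) then (m : ℝ) ^ 3 * ‖cellFourierCoeff L φ k‖ ^ 2 else 0 : ℝ)) : ℝ) :
          ℂ) := by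
  have h := hasSum_grid hL hm hφ hper
  set v : ℂ := ((L ^ 3)⁻¹ : ℝ) • ∑ j : Fin 3 → Fin m,
    ∫ x in cell L, conj (φ (x + latticeVec (L / m) (fun a => ((j a : ℕ) : ℤ)))) * φ x with hv
  have hre : HasSum (fun k : Fin 3 → ℤ =>
      (if (∀ a, (m : ℤ) ∣ k a) then (m : ℝ) ^ 3 * ‖cellFourierCoeff L φ k‖ ^ 2 else 0 : ℝ)) v.re := by
    have := Complex.reCLM.hasSum h
    simpa only [Complex.reCLM_apply, Complex.ofReal_re] using this
  have him : v.im = 0 := by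
    have h1 : HasSum (fun _ : Fin 3 → ℤ => (0 : ℝ)) v.im := by
      have := Complex.imCLM.hasSum h
      simpa only [Complex.imCLM_apply, Complex.ofReal_im] using this
    exact h1.unique hasSum_zero
  refine ⟨hre.summable, ?_⟩
  have hL3 : (L ^ 3 : ℝ) ≠ 0 := pow_ne_zero _ hL.ne'
  have hvS : (∑ j : Fin 3 → Fin m,
      ∫ x in cell L, conj (φ (x + latticeVec (L / m) (fun a => ((j a : ℕ) : ℤ)))) * φ x) =
        (L ^ 3 : ℝ) • v := by
    rw [hv, smul_smul, mul_inv_cancel₀ hL3, one_smul]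
  have hvre : v = ((v.re : ℝ) : ℂ) := Complex.ext (by simp) (by simp [him])
  rw [hvS, hvre, hre.tsum_eq, Complex.real_smul, ← Complex.ofReal_mul]

/-- **Aliasing bound in `ℝ≥0∞`**: `Σ_{k ∈ mℤ³} |ĉ_k|² ≤ |ĉ_0|² + (L²/(4π²m²)) Σ_k |2πk/L|² |ĉ_k|²`
(`|k| ≥ m` on `mℤ³ ∖ {0}`). [folklore] -/
theorem tsum_coarse_le (hL : 0 < L) {m : ℕ} (hm : 0 < m) (c : (Fin 3 → ℤ) → ℂ) :
    (∑' k : Fin 3 → ℤ, (if (∀ a, (m : ℤ) ∣ k a) then ((‖c k‖₊ : ℝ≥0∞) ^ 2) else 0)) ≤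
      (‖c 0‖₊ : ℝ≥0∞) ^ 2 + ENNReal.ofReal (L ^ 2 / (4 * Real.pi ^ 2 * (m : ℝ) ^ 2)) *
        ∑' k : Fin 3 → ℤ, ENNReal.ofReal (‖waveVector L k‖ ^ 2) * (‖c k‖₊ : ℝ≥0∞) ^ 2 := by
  classical
  set κ : ℝ≥0∞ := ENNReal.ofReal (L ^ 2 / (4 * Real.pi ^ 2 * (m : ℝ) ^ 2)) with hκ
  -- the weight is `≥ 1` on the coarse lattice minus the origin
  have hweight : ∀ k : Fin 3 → ℤ, k ≠ 0 → (∀ a, (m : ℤ) ∣ k a) →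
      1 ≤ κ * ENNReal.ofReal (‖waveVector L k‖ ^ 2) := by
    intro k hk hD
    obtain ⟨a, ha⟩ := Function.ne_iff.1 hk
    have hle : (m : ℤ) ≤ |k a| := Int.le_of_dvd (abs_pos.2 ha) ((dvd_abs _ _).2 (hD a))
    have hle' : (m : ℝ) ≤ |(k a : ℝ)| := by
      rw [← Int.cast_abs]; exact_mod_cast hle
    have hsq : (m : ℝ) ^ 2 ≤ (k a : ℝ) ^ 2 := by
      rw [← sq_abs (k a : ℝ)]
      exact pow_le_pow_left₀ (Nat.cast_nonneg m) hle' 2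
    have hsum : (k a : ℝ) ^ 2 ≤ ∑ b, (k b : ℝ) ^ 2 :=
      Finset.single_le_sum (f := fun b => (k b : ℝ) ^ 2) (fun b _ => sq_nonneg _) (Finset.mem_univ a)
    have hm' : (0 : ℝ) < (m : ℝ) ^ 2 := by positivity
    rw [hκ, ← ENNReal.ofReal_mul (by positivity), norm_waveVector_sq, ENNReal.one_le_ofReal]
    have : L ^ 2 / (4 * Real.pi ^ 2 * (m : ℝ) ^ 2) * (4 * Real.pi ^ 2 * (∑ b, (k b : ℝ) ^ 2) / L ^ 2) =
        (∑ b, (k b : ℝ) ^ 2) / (m : ℝ) ^ 2 := by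
      field_simp
    rw [this, one_le_div hm']
    linarith
  -- termwise comparison
  have hpt : ∀ k : Fin 3 → ℤ, (if (∀ a, (m : ℤ) ∣ k a) then ((‖c k‖₊ : ℝ≥0∞) ^ 2) else 0) ≤
      (if k = 0 then (‖c 0‖₊ : ℝ≥0∞) ^ 2 else 0) +
        κ * (ENNReal.ofReal (‖waveVector L k‖ ^ 2) * (‖c k‖₊ : ℝ≥0∞) ^ 2) := by
    intro k
    by_cases hk : k = 0
    · subst hk
      simp
    · rw [if_neg hk, zero_add]
      split_ifs with hD
      · calc ((‖c k‖₊ : ℝ≥0∞) ^ 2) = 1 * (‖c k‖₊ : ℝ≥0∞) ^ 2 := (one_mul _).symm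
          _ ≤ (κ * ENNReal.ofReal (‖waveVector L k‖ ^ 2)) * (‖c k‖₊ : ℝ≥0∞) ^ 2 :=
              mul_le_mul' (hweight k hk hD) le_rfl
          _ = κ * (ENNReal.ofReal (‖waveVector L k‖ ^ 2) * (‖c k‖₊ : ℝ≥0∞) ^ 2) := mul_assoc _ _ _
      · exact bot_le
  calc (∑' k : Fin 3 → ℤ, (if (∀ a, (m : ℤ) ∣ k a) then ((‖c k‖₊ : ℝ≥0∞) ^ 2) else 0))
      ≤ ∑' k : Fin 3 → ℤ, ((if k = 0 then (‖c 0‖₊ : ℝ≥0∞) ^ 2 else 0) +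
          κ * (ENNReal.ofReal (‖waveVector L k‖ ^ 2) * (‖c k‖₊ : ℝ≥0∞) ^ 2)) :=
        ENNReal.tsum_le_tsum hpt
    _ = (‖c 0‖₊ : ℝ≥0∞) ^ 2 +
          κ * ∑' k : Fin 3 → ℤ, ENNReal.ofReal (‖waveVector L k‖ ^ 2) * (‖c k‖₊ : ℝ≥0∞) ^ 2 := by
        rw [ENNReal.tsum_add, tsum_ite_eq, ENNReal.tsum_mul_left]

end Summit.AtomisticToContinuum.BoseEinsteinCondensation.Theorems.BECInfDivCoherenceGridAverage

end
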